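import Summits.ValiantsHypothesis.ValiantsHypothesis.Theorems.GrenetZeonDualUnipotentThreeHalvesLongMassSeparatedProducts

/-!
# `GrenetZeon.DualUnipotentThreeHalves` (stmt-ValiantsHypothesis-24318), line `slow_core`, stub (c) `SlowCore.LongMassSlowLawInv`:
# THE FREE TRIANGULAR PENCIL IS EXPENSIVE — `(P + n + 2b)² ≥ 2·n·b²` for every certificate price `P`, and (c) FAILS AT `c = 1`

Sequel to ✓ `…LongMassSeparatedProducts` (`exists_dead_of_ledger`: in a whole-pencil ledger `(K, k)` of the free triangular pencil with
`2k + 2 ≤ n`, every SEPARATED `(k+1)`-tuple of positions carries a coordinate that vanishes identically on `K`).  Here the count and the price: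

* `card_dead_le` — `#{dead coordinates} ≤ n² − finrank K` (`K` lies in the span of the coordinate vectors it does not kill; ✓ `finrank_span_single`).
* ★ `card_alive_le` — on diagonal `d ≥ 1` at most `k·(d+1)` starting rows are alive: `k·(d+1) + 1` alive rows contain `k + 1` rows pairwise `≥ d+1`
  apart (every `(d+1)`-st one in increasing order, `apply_add_le_of_strictMono`), i.e. a separated tuple — contradiction.  `le_card_dead`: so
  `≥ (b − d) − k·(d+1)` rows of diagonal `d` are dead.
* ★ `sum_le_codim` — distinct diagonals give distinct coordinates: `Σ_{d<L} ((b − (d+1)) − k(d+2)) ≤ n² − finrank K` for every `L`.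
* ★ `price_floor` (pluggable form) — every certificate price `P` has an order `k` with `n·k + Σ_{d<L} ((b−(d+1)) − k(d+2)) ≤ P` for all `L`
  (window `2k + 2 ≤ n`), or `n·k ≤ P` with `n < 2k + 2`.
* `two_mul_sum_add` (Gauss), `sq_le_dead_count` (`b² ≤ 2u·T + 4u·b` at `u = k+1`, `L = ⌊b/u⌋ − 1`) — the elementary optimisation.
* ★★★ `two_mul_sq_le_of_relCert` — **`RelCert n b 𝔫_b P ⟹ (P + n + 2b)² ≥ 2·n·b²`**, i.e. `P ≥ √2·√n·b − n − 2b`: with the flag / block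
  certificates (`O(√n·b)`: ✓ `window_of_flag`, ✓ `relCert_of_affineValues_le`; the `(k+1)`-block certificate gives `≈ √2·√n·b + O(n + b)`) the FIRST
  TWO-SIDED PRICE COMPUTATION of the (c)-programme — the conjectured rate `√n·b` is ATTAINED by `𝔫_b` with leading constant `√2` from below.
  `not_relCert_of_sq_lt` (census form), `not_relCert_sqrt_mul` (`n ≥ 100`: no certificate of `𝔫_n` of price `≤ √n·n`).
* ★★★ `not_longMassSlowLawAll_one` — **the `c = 1` instance of the body of ✓ `LongMassIrreducibilityFree.LongMassSlowLawAll` is FALSE**: the constant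
  of (c) (⟺ `LongMassSlowLawAll` by ✓ `inv_iff_all`, constants `c ↦ c + 10`) is `≥ 2`.  What refutes (c) itself is a family beating `𝔫_b` by an
  UNBOUNDED factor; this file shows the instrument needed for such lower bounds exists in the kernel and is sharp on `𝔫_b`.

HONEST FRAMING.  Calibration / instrument (`--supports stmt-ValiantsHypothesis-24318`); (c) `LongMassSlowLawInv` (∃ c) is RESEARCH — OPEN and is
neither proved nor refuted here; closes no stub; S3, 24318, 8062 (`stub_dualUnipotent`) and `VP ≠ VNP` are NOT proved.  Def-free, no named facts,
no sorry.  [folklore; the count is the arithmetic-progression form of «a bounded-index subspace of 𝔫_b has codimension ≳ b²/(2(k+1))»]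
-/

set_option linter.dupNamespace false
set_option autoImplicit false

noncomputable section

namespace Summit.ValiantsHypothesis.ValiantsHypothesis.Theorems.GrenetZeon.FreeTriangularPrice

open MvPolynomial Matrix
open scoped BigOperators
open Summit.ValiantsHypothesis.ValiantsHypothesis.Cruxes.TwoDimCoefficients.DimTwoCases (AffMat IsAffine)
open Summit.ValiantsHypothesis.ValiantsHypothesis.Theorems.GrenetZeon.RadicalSplit (lineSubst)
open Summit.ValiantsHypothesis.ValiantsHypothesis.Theorems.GrenetZeon.SlowCore (linEntry Ledger RelCert)
open Summit.ValiantsHypothesis.ValiantsHypothesis.Theorems.GrenetZeon.ResolventFlag (pointMat linMat)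
open Summit.ValiantsHypothesis.ValiantsHypothesis.Theorems.GrenetZeon.MonomialWalk (map_lineSubst_eq_pointMat)
open Summit.ValiantsHypothesis.ValiantsHypothesis.Theorems.GrenetZeon.InitialForm.SlowCurve (totalDegree_le_iff_coeff)
open Summit.ValiantsHypothesis.ValiantsHypothesis.Theorems.GrenetZeon.InitialForm.SlowTorus (finrank_span_single)

/-! ## §3 Counting the dead coordinates: at most `k·(d+1)` positions of diagonal `d` survive -/

section Counting
variable {n b : ℕ}

/-- Strictly monotone maps `Fin N → ℕ` spread points: `f i + (j − i) ≤ f j`. [folklore] -/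
theorem apply_add_le_of_strictMono {N : ℕ} (f : Fin N → ℕ) (hf : StrictMono f) :
    ∀ (t : ℕ) (i j : Fin N), (j : ℕ) = i + t → f i + t ≤ f j := by
  intro t
  induction t with
  | zero => intro i j h; rw [Nat.add_zero, show j = i from Fin.ext (by omega)]
  | succ t ih =>
    intro i j h
    have hj' : (i : ℕ) + t < N := by omega
    have h1 := ih i ⟨i + t, hj'⟩ rfl
    have h2 : f ⟨i + t, hj'⟩ < f j := hf (Fin.lt_def.mpr (by change (i : ℕ) + t < (j : ℕ); omega))
    omega

/-- `K` lies in the span of the coordinate vectors it does not annihilate, so the number of DEAD coordinates (`v c = 0` on `K`) is at most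
`n² − finrank K`. -/
theorem card_dead_le (K : Submodule ℂ (Fin n × Fin n → ℂ)) (D : Finset (Fin n × Fin n)) (hD : ∀ c ∈ D, ∀ v ∈ K, v c = 0) :
    D.card ≤ n * n - Module.finrank ℂ K := by
  classical
  have hle : K ≤ Submodule.span ℂ (Set.range fun e : (Dᶜ : Finset (Fin n × Fin n)) =>
      (Pi.single (e : Fin n × Fin n) (1 : ℂ) : Fin n × Fin n → ℂ)) := by
    intro v hv
    have hsum : v = ∑ e ∈ Dᶜ, v e • (Pi.single e (1 : ℂ) : Fin n × Fin n → ℂ) := by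
      calc v = ∑ e, (Pi.single e (v e) : Fin n × Fin n → ℂ) := (Finset.univ_sum_single v).symm
        _ = ∑ e, v e • (Pi.single e (1 : ℂ) : Fin n × Fin n → ℂ) := Finset.sum_congr rfl fun e _ => by
              ext c; simp [Pi.single_apply]
        _ = ∑ e ∈ Dᶜ, v e • (Pi.single e (1 : ℂ) : Fin n × Fin n → ℂ) := by
              rw [← Finset.sum_compl_add_sum D, Finset.sum_eq_zero (s := D) (fun e he => by rw [hD e he v hv, zero_smul]),
                add_zero]
    rw [hsum]
    exact Submodule.sum_mem _ fun e he => Submodule.smul_mem _ _ (Submodule.subset_span ⟨⟨e, he⟩, rfl⟩)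
  have h1 := Submodule.finrank_mono hle
  rw [finrank_span_single] at h1
  have h2 : (Dᶜ).card = n * n - D.card := by rw [Finset.card_compl, Fintype.card_prod, Fintype.card_fin]
  have h3 : D.card ≤ n * n := by
    calc D.card ≤ Fintype.card (Fin n × Fin n) := Finset.card_le_univ _
      _ = n * n := by rw [Fintype.card_prod, Fintype.card_fin]
  omega

open Classical in
/-- ★ **AT MOST `k·(d+1)` LIVE POSITIONS ON DIAGONAL `d`.**  For a whole-pencil ledger `(K, k)` of the free triangular pencil (window `2k + 2 ≤ n`),
the starting rows `a` (`a + d < b`) whose coordinate `(ι a, ι (a+d))` is NOT killed by `K` number at most `k·(d+1)`: otherwise `k + 1` of them are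
pairwise `≥ d + 1` apart, i.e. SEPARATED, and `exists_dead_of_ledger` kills one.  (`fb` is any enumeration `ℕ → Fin b` exact below `b`.) -/
theorem card_alive_le (ι : Fin b → Fin n) (hι : Function.Injective ι) (N : AffMat n b)
    (hN : ∀ i j, N i j = if i < j then X (ι i, ι j) else 0)
    {K : Submodule ℂ (Fin n × Fin n → ℂ)} {k : ℕ} (hK : Ledger n b N (fun _ => True) K k) (hk : 2 * k + 2 ≤ n)
    (fb : ℕ → Fin b) (hfb : ∀ a, a < b → ((fb a : Fin b) : ℕ) = a) {d : ℕ} (hd : 1 ≤ d) :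
    ((Finset.range (b - d)).filter (fun a => ¬ ∀ v ∈ K, v (ι (fb a), ι (fb (a + d))) = 0)).card ≤ k * (d + 1) := by
  classical
  set S := (Finset.range (b - d)).filter (fun a => ¬ ∀ v ∈ K, v (ι (fb a), ι (fb (a + d))) = 0) with hS
  by_contra hcon
  push Not at hcon
  set M := S.card with hM
  have hM1 : k * (d + 1) + 1 ≤ M := hcon
  set f : Fin M ↪o ℕ := S.orderEmbOfFin rfl with hf
  have hfmem : ∀ i, f i ∈ S := fun i => S.orderEmbOfFin_mem rfl i
  -- the chain `a l = f (l·(d+1))`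
  set a : ℕ → ℕ := fun l => f ⟨min (l * (d + 1)) (M - 1), by omega⟩ with ha
  have hamem : ∀ l, a l ∈ S := fun l => hfmem _
  have halt : ∀ l, a l < b - d := fun l => Finset.mem_range.mp (Finset.mem_filter.mp (hamem l)).1
  have halive : ∀ l, ¬ ∀ v ∈ K, v (ι (fb (a l)), ι (fb (a l + d))) = 0 := fun l => (Finset.mem_filter.mp (hamem l)).2
  have hgap : ∀ l, l < k → a l + (d + 1) ≤ a (l + 1) := by
    intro l hl
    have hlk : (l + 1) * (d + 1) ≤ k * (d + 1) := Nat.mul_le_mul_right _ (by omega)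
    have hld : (l + 1) * (d + 1) = l * (d + 1) + (d + 1) := by ring
    have h1 : min (l * (d + 1)) (M - 1) = l * (d + 1) := min_eq_left (by omega)
    have h2 : min ((l + 1) * (d + 1)) (M - 1) = (l + 1) * (d + 1) := min_eq_left (by omega)
    exact apply_add_le_of_strictMono (fun i => f i) f.strictMono (d + 1) ⟨min (l * (d + 1)) (M - 1), by omega⟩
      ⟨min ((l + 1) * (d + 1)) (M - 1), by omega⟩ (by simp only [h1, h2]; ring)
  -- the separated positions
  set r : ℕ → Fin b := fun l => fb (a l) with hr
  set r' : ℕ → Fin b := fun l => fb (a l + d) with hr'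
  have hrv : ∀ l, ((r l : Fin b) : ℕ) = a l := fun l => hfb _ (by have := halt l; omega)
  have hr'v : ∀ l, ((r' l : Fin b) : ℕ) = a l + d := fun l => hfb _ (by have := halt l; omega)
  have hrr' : ∀ l, l ≤ k → r l < r' l := fun l _ => Fin.lt_def.mpr (by rw [hrv, hr'v]; omega)
  have hsep : ∀ l, l < k → r' l < r (l + 1) := fun l hl => Fin.lt_def.mpr (by rw [hrv, hr'v]; have := hgap l hl; omega)
  obtain ⟨l, -, hl⟩ := exists_dead_of_ledger ι hι N hN hK hk r r' hrr' hsep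
  exact halive l hl

open Classical in
/-- Hence at least `(b − d) − k·(d+1)` starting rows of diagonal `d ≥ 1` carry a DEAD coordinate. -/
theorem le_card_dead (ι : Fin b → Fin n) (hι : Function.Injective ι) (N : AffMat n b)
    (hN : ∀ i j, N i j = if i < j then X (ι i, ι j) else 0)
    {K : Submodule ℂ (Fin n × Fin n → ℂ)} {k : ℕ} (hK : Ledger n b N (fun _ => True) K k) (hk : 2 * k + 2 ≤ n)
    (fb : ℕ → Fin b) (hfb : ∀ a, a < b → ((fb a : Fin b) : ℕ) = a) {d : ℕ} (hd : 1 ≤ d) :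
    (b - d) - k * (d + 1) ≤ ((Finset.range (b - d)).filter (fun a => ∀ v ∈ K, v (ι (fb a), ι (fb (a + d))) = 0)).card := by
  classical
  have h := Finset.card_filter_add_card_filter_not (s := Finset.range (b - d))
    (fun a => ∀ v ∈ K, v (ι (fb a), ι (fb (a + d))) = 0)
  rw [Finset.card_range] at h
  have := card_alive_le ι hι N hN hK hk fb hfb hd
  omega

/-- ★ **THE DEAD-COORDINATE COUNT.**  For a whole-pencil ledger `(K, k)` of the free triangular pencil with window `2k + 2 ≤ n`:
`Σ_{d < L} ((b − (d+1)) − k·(d+2)) ≤ n² − finrank K` for every `L` (diagonals `1, …, L`; distinct diagonals give distinct coordinates). -/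
theorem sum_le_codim (ι : Fin b → Fin n) (hι : Function.Injective ι) (N : AffMat n b)
    (hN : ∀ i j, N i j = if i < j then X (ι i, ι j) else 0)
    {K : Submodule ℂ (Fin n × Fin n → ℂ)} {k : ℕ} (hK : Ledger n b N (fun _ => True) K k) (hk : 2 * k + 2 ≤ n)
    (fb : ℕ → Fin b) (hfb : ∀ a, a < b → ((fb a : Fin b) : ℕ) = a) (L : ℕ) :
    ∑ d ∈ Finset.range L, ((b - (d + 1)) - k * (d + 2)) ≤ n * n - Module.finrank ℂ K := by
  classical
  set D : Finset (Fin n × Fin n) := Finset.univ.filter (fun c => ∀ v ∈ K, v c = 0) with hD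
  refine le_trans ?_ (card_dead_le K D (fun c hc => (Finset.mem_filter.mp hc).2))
  set T : ℕ → Finset ℕ := fun d => (Finset.range (b - (d + 1))).filter
    (fun a => ∀ v ∈ K, v (ι (fb a), ι (fb (a + (d + 1)))) = 0) with hT
  set φ : ℕ → ℕ → Fin n × Fin n := fun d a => (ι (fb a), ι (fb (a + (d + 1)))) with hφ
  -- faithfulness of `φ` on valid positions
  have hφinj : ∀ d a d' a', a < b - (d + 1) → a' < b - (d' + 1) → φ d a = φ d' a' → a = a' ∧ d = d' := by
    intro d a d' a' ha ha' h
    obtain ⟨h1, h2⟩ := Prod.mk.inj h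
    have e1 : ((fb a : Fin b) : ℕ) = ((fb a' : Fin b) : ℕ) := congrArg Fin.val (hι h1)
    have e2 : ((fb (a + (d + 1)) : Fin b) : ℕ) = ((fb (a' + (d' + 1)) : Fin b) : ℕ) := congrArg Fin.val (hι h2)
    rw [hfb _ (by omega), hfb _ (by omega)] at e1 e2
    exact ⟨e1, by omega⟩
  have hsub : (Finset.range L).biUnion (fun d => (T d).image (φ d)) ⊆ D := by
    intro c hc
    obtain ⟨d, -, hc⟩ := Finset.mem_biUnion.mp hc
    obtain ⟨a, ha, rfl⟩ := Finset.mem_image.mp hc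
    exact Finset.mem_filter.mpr ⟨Finset.mem_univ _, (Finset.mem_filter.mp ha).2⟩
  have hdisj : ((Finset.range L : Finset ℕ) : Set ℕ).PairwiseDisjoint (fun d => (T d).image (φ d)) := by
    intro d _ d' _ hne
    rw [Function.onFun, Finset.disjoint_left]
    intro c hc hc'
    obtain ⟨a, ha, rfl⟩ := Finset.mem_image.mp hc
    obtain ⟨a', ha', h⟩ := Finset.mem_image.mp hc'
    have hab := Finset.mem_range.mp (Finset.mem_filter.mp ha).1
    have hab' := Finset.mem_range.mp (Finset.mem_filter.mp ha').1
    exact hne (hφinj d a d' a' hab hab' h.symm).2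
  calc ∑ d ∈ Finset.range L, ((b - (d + 1)) - k * (d + 2))
      ≤ ∑ d ∈ Finset.range L, ((T d).image (φ d)).card := Finset.sum_le_sum fun d _ => by
          rw [Finset.card_image_of_injOn (fun a ha a' ha' h =>
            (hφinj d a d a' (Finset.mem_range.mp (Finset.mem_filter.mp ha).1)
              (Finset.mem_range.mp (Finset.mem_filter.mp ha').1) h).1)]
          exact le_card_dead ι hι N hN hK hk fb hfb (d := d + 1) (by omega)
    _ = ((Finset.range L).biUnion (fun d => (T d).image (φ d))).card := (Finset.card_biUnion hdisj).symm
    _ ≤ D.card := Finset.card_le_card hsub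

end Counting

/-! ## §4 The price floor and its closed form -/

section Price
variable {n b : ℕ}

/-- ★ **PRICE FLOOR (pluggable form).**  Every certificate of the free triangular pencil has an order `k` with: either the window sees `2k + 1`
and `n·k + Σ_{d<L} ((b − (d+1)) − k·(d+2)) ≤ P` for EVERY `L`, or `n < 2k + 2` and `n·k ≤ P`. -/
theorem price_floor (ι : Fin b → Fin n) (hι : Function.Injective ι) (N : AffMat n b)
    (hN : ∀ i j, N i j = if i < j then X (ι i, ι j) else 0) {P : ℕ} (h : RelCert n b N P) :
    ∃ k : ℕ, (2 * k + 2 ≤ n ∧ ∀ L : ℕ, n * k + ∑ d ∈ Finset.range L, ((b - (d + 1)) - k * (d + 2)) ≤ P) ∨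
      (n < 2 * k + 2 ∧ n * k ≤ P) := by
  obtain ⟨K, k, hK, hprice⟩ := h
  refine ⟨k, ?_⟩
  by_cases hk : 2 * k + 2 ≤ n
  · left
    refine ⟨hk, fun L => ?_⟩
    rcases Nat.eq_zero_or_pos b with hb | hb
    · subst hb
      have : ∑ d ∈ Finset.range L, ((0 - (d + 1)) - k * (d + 2)) = 0 := Finset.sum_eq_zero fun d _ => by omega
      rw [this]; omega
    · have := sum_le_codim ι hι N hN hK hk (fun a => if h : a < b then ⟨a, h⟩ else ⟨0, hb⟩)
        (fun a ha => by simp [ha]) L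
      omega
  · right; exact ⟨by omega, by omega⟩

/-- Gauss bookkeeping: `2·Σ_{d<L} (b + 1 − u(d+2)) + u·L·(L+3) = 2·L·(b+1)` as long as no term is truncated (`u(L+1) ≤ b + 1`). -/
theorem two_mul_sum_add (b u : ℕ) : ∀ L : ℕ, u * (L + 1) ≤ b + 1 →
    2 * (∑ d ∈ Finset.range L, (b + 1 - u * (d + 2))) + u * L * (L + 3) = 2 * L * (b + 1) := by
  intro L
  induction L with
  | zero => intro _; simp
  | succ L ih =>
    intro hL
    have hL' : u * (L + 1) ≤ b + 1 := le_trans (Nat.mul_le_mul_left _ (by omega)) hL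
    have h := ih hL'
    rw [Finset.sum_range_succ]
    have ht : b + 1 - u * (L + 2) + u * (L + 2) = b + 1 := Nat.sub_add_cancel hL
    have e1 : u * (L + 1 + 3) = u * (L + 3) + u := by ring
    have e2 : u * (L + 2) = u * (L + 1) + u := by ring
    nlinarith [h, ht, e1, e2]

/-- The elementary optimisation behind `√2`: with `u = k + 1`, `L = ⌊b/u⌋ − 1` and `T` the dead count, `b² ≤ 2u·T + 4u·b`. -/
theorem sq_le_dead_count (b k : ℕ) :
    b * b ≤ 2 * (k + 1) * (∑ d ∈ Finset.range (b / (k + 1) - 1), ((b - (d + 1)) - k * (d + 2))) + 4 * (k + 1) * b := by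
  set u := k + 1 with hu
  set q := b / u with hq
  have hu1 : 1 ≤ u := by omega
  have hqb : u * q ≤ b := Nat.mul_div_le b u
  have hbq : b < u * q + u := by
    have := Nat.lt_div_mul_add (a := b) (b := u) (by omega)
    rw [← hq] at this; linarith [Nat.mul_comm q u]
  -- rewrite the terms without truncation
  have hterm : ∀ d ∈ Finset.range (q - 1), (b - (d + 1)) - k * (d + 2) = b + 1 - u * (d + 2) := by
    intro d _
    have : u * (d + 2) = k * (d + 2) + (d + 2) := by rw [hu]; ring
    omega
  rw [Finset.sum_congr rfl hterm]
  rcases Nat.eq_zero_or_pos q with hq0 | hq0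
  · rw [hq0]
    simp only [Nat.zero_sub, Finset.range_zero, Finset.sum_empty, mul_zero, zero_add]
    rw [hq0, mul_zero, zero_add] at hbq
    nlinarith
  · set L := q - 1 with hL
    have hLq : L + 1 = q := by omega
    have hgauss := two_mul_sum_add b u L (by rw [hLq]; omega)
    set T := ∑ d ∈ Finset.range L, (b + 1 - u * (d + 2)) with hT
    -- `b = u (L+1) + δ`, `δ < u`
    obtain ⟨δ, hδ⟩ : ∃ δ, b = u * (L + 1) + δ := ⟨b - u * (L + 1), by rw [hLq]; omega⟩
    have hδu : δ < u := by rw [hLq] at hδ; omega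
    have hδ2 : δ * δ ≤ 2 * u * δ := Nat.mul_le_mul_right δ (by omega)
    have huu : u ≤ u * u := Nat.le_mul_self u
    -- `b² + u²L(L+3) ≤ 2uL(b+1) + 4ub`, then subtract the Gauss identity multiplied by `u`
    have key : b * b + u * (u * L * (L + 3)) ≤ u * (2 * L * (b + 1)) + 4 * u * b := by
      rw [hδ]; nlinarith [hδ2, huu, hδu, hu1]
    have hg' : u * (2 * T) + u * (u * L * (L + 3)) = u * (2 * L * (b + 1)) := by
      rw [← hgauss]; ring
    nlinarith [key, hg']

/-- ★★★ **THE FREE TRIANGULAR PENCIL IS EXPENSIVE.**  Every certificate price `P` of the free strictly upper triangular `b × b` pencil on `n²`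
coordinates (`b ≤ n` forced by the injective placement `ι`) satisfies `(P + n + 2b)² ≥ 2·n·b²`, i.e. `P ≥ √2·√n·b − n − 2b`.  Together with the
flag/band certificates (price `O(√n·b)`, ✓ `window_of_flag` / `relCert_of_affineValues_le`) this is the first TWO-SIDED price computation of the
(c)-programme: the rate `√n·b` of (c) `LongMassSlowLawInv` is attained, up to the constant, by `𝔫_b`. -/
theorem two_mul_sq_le_of_relCert (ι : Fin b → Fin n) (hι : Function.Injective ι) (N : AffMat n b)
    (hN : ∀ i j, N i j = if i < j then X (ι i, ι j) else 0) {P : ℕ} (h : RelCert n b N P) :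
    2 * n * (b * b) ≤ (P + n + 2 * b) ^ 2 := by
  have hbn : b ≤ n := by simpa using Fintype.card_le_of_injective ι hι
  obtain ⟨k, hk⟩ := price_floor ι hι N hN h
  rcases hk with ⟨hkn, hL⟩ | ⟨hkn, hP⟩
  · have hsum := hL (b / (k + 1) - 1)
    have hsq := sq_le_dead_count b k
    set T := ∑ d ∈ Finset.range (b / (k + 1) - 1), ((b - (d + 1)) - k * (d + 2)) with hT
    set u := k + 1 with hu
    -- `2u (P + n + 2b) ≥ 2 n u² + b²`
    have h1 : 2 * n * (u * u) + b * b ≤ 2 * u * (P + n + 2 * b) := by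
      have : n * k + n = n * u := by rw [hu]; ring
      nlinarith [hsum, hsq, this]
    -- square and use `(x + y)² ≥ 4xy`
    have h2 : 4 * (2 * n * (u * u)) * (b * b) ≤ (2 * u * (P + n + 2 * b)) * (2 * u * (P + n + 2 * b)) := by
      have hsq' := Nat.mul_self_le_mul_self h1
      nlinarith [hsq', Nat.zero_le (2 * n * (u * u)), Nat.zero_le (b * b), sq_nonneg ((2 * n * (u * u) : ℤ) - (b * b : ℤ))]
    have hu0 : 0 < 4 * (u * u) := by positivity
    refine Nat.le_of_mul_le_mul_left ?_ hu0
    calc 4 * (u * u) * (2 * n * (b * b)) = 4 * (2 * n * (u * u)) * (b * b) := by ring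
      _ ≤ (2 * u * (P + n + 2 * b)) * (2 * u * (P + n + 2 * b)) := h2
      _ = 4 * (u * u) * (P + n + 2 * b) ^ 2 := by ring
  · -- outside the window: `P ≥ n k ≥ n (n − 1) / 2`
    have h1 : n * (n + 1) ≤ 2 * (P + n) := by nlinarith [hP, hkn]
    have h2 : n * (n + 1) + 4 * b ≤ 2 * (P + n + 2 * b) := by omega
    have h3 : (n * (n + 1) + 4 * b) ^ 2 ≤ (2 * (P + n + 2 * b)) ^ 2 := Nat.pow_le_pow_left h2 2
    have h4 : 16 * (n * (n + 1)) * b ≤ (n * (n + 1) + 4 * b) ^ 2 := by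
      have : (16 * (n * (n + 1)) * b : ℤ) ≤ ((n * (n + 1) + 4 * b) ^ 2 : ℤ) := by
        nlinarith [sq_nonneg ((n * (n + 1) : ℤ) - 4 * b)]
      exact_mod_cast this
    have h5 : 16 * n * (b * b) ≤ 16 * (n * (n + 1)) * b := by
      have : b * b ≤ (n + 1) * b := Nat.mul_le_mul_right b (by omega)
      nlinarith [this]
    have e : (2 * (P + n + 2 * b)) ^ 2 = 4 * (P + n + 2 * b) ^ 2 := by ring
    nlinarith [h3, h4, h5, e]

/-- Contrapositive census form. -/
theorem not_relCert_of_sq_lt (ι : Fin b → Fin n) (hι : Function.Injective ι) (N : AffMat n b)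
    (hN : ∀ i j, N i j = if i < j then X (ι i, ι j) else 0) {P : ℕ} (hP : (P + n + 2 * b) ^ 2 < 2 * n * (b * b)) :
    ¬ RelCert n b N P :=
  fun h => absurd (two_mul_sq_le_of_relCert ι hι N hN h) (not_le.mpr hP)

/-- ★ **`c = 1` IS TOO CHEAP FOR `𝔫_n`.**  For `n ≥ 100` the free strictly upper triangular `n × n` pencil (placement `ι = id`, `n(n−1)/2 ≤ n²`
coordinates, `N ^ n = 0`) has NO certificate of price `≤ √n·n`. -/
theorem not_relCert_sqrt_mul (hn : 100 ≤ n) (N : AffMat n n) (hN : ∀ i j, N i j = if i < j then X (i, j) else 0) :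
    ¬ RelCert n n N (Nat.sqrt n * n) := by
  intro h
  have hmain := two_mul_sq_le_of_relCert (b := n) id Function.injective_id N hN h
  set s := Nat.sqrt n with hs
  have hs1 : s * s ≤ n := Nat.sqrt_le n
  have hs2 : n < (s + 1) * (s + 1) := Nat.lt_succ_sqrt n
  have hn0 : 0 < n * n := by positivity
  have h2 : n * n * (2 * n) ≤ n * n * ((s + 3) * (s + 3)) := by
    have : (s * n + n + 2 * n) ^ 2 = n * n * ((s + 3) * (s + 3)) := by ring
    rw [← this]; simpa [id, mul_comm, mul_assoc, mul_left_comm] using hmain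
  have h3 : 2 * n ≤ (s + 3) * (s + 3) := Nat.le_of_mul_le_mul_left h2 hn0
  nlinarith [h3, hs1, hs2, hn]

/-- ★★★ **(c) FAILS AT `c = 1`: the constant of `LongMassSlowLawAll` (⟺ (c) `LongMassSlowLawInv`, ✓ `inv_iff_all`) is at least `2`.**  The `c = 1`
instance of the body of ✓ `LongMassIrreducibilityFree.LongMassSlowLawAll` is false: at every `n ≥ 100` the free triangular `n × n` pencil is an affine
nilpotent pencil without a certificate of price `≤ 1·(√n·n)`.  ((c) itself — SOME constant `c` — stays OPEN; this only pins the rate.) -/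
theorem not_longMassSlowLawAll_one :
    ¬ ∃ n₀ : ℕ, ∀ n ≥ n₀, ∀ b : ℕ, ∀ B : AffMat n b, IsAffine B → B ^ b = 0 → RelCert n b B (1 * (Nat.sqrt n * b)) := by
  rintro ⟨n₀, h⟩
  set n := max n₀ 100 with hn
  set N : AffMat n n := Matrix.of fun i j => if i < j then X (i, j) else 0 with hNdef
  have hN : ∀ i j, N i j = if i < j then X ((id i : Fin n), (id j : Fin n)) else 0 := fun i j => rfl
  have h1 := h n (le_max_left _ _) n N (isAffine_free id N hN) (pow_eq_zero_free id N hN)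
  rw [one_mul] at h1
  exact not_relCert_sqrt_mul (le_max_right _ _) N hN h1

end Price

end Summit.ValiantsHypothesis.ValiantsHypothesis.Theorems.GrenetZeon.FreeTriangularPrice

end
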